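import Mathlib
import Literature.Probability.Percolation.DiagonalStripGenericSwap
import Literature.Probability.Percolation.DiagonalStripGenericInversion
import HarnessLib

/-!
# Residue sums over the rapidities (the algebraic form of Hagendorf–Liénardy's contour integrals)

Topic `Literature/Probability/Percolation`. Hagendorf–Liénardy (J. Stat. Mech. (2021) 013104,
arXiv:2008.03220, §3.1) construct the solution of the boundary quantum Knizhnik–Zamolodchikov
equations of the open XXZ chain at `Δ = -1/2` as multiple contour integrals
`∮⋯∮ ∏ dw_ℓ/(πi w_ℓ) Ξ(w_1, …, w_n | z_1, …, z_L)` whose contours surround the simple poles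
`w_ℓ = z_j` only. Such an integral is a finite **residue sum**: writing the integrand over the
universal denominator `∏_ℓ ∏_j [z_j/w_ℓ]` (`[x] = x - x⁻¹`), it equals
`Σ_{J : Fin n ↪ Fin L} N(z_{J(0)}, …, z_{J(n-1)}) · ∏_ℓ ρ(J ℓ)` with the universal weights
`ρ(j) = -(∏_{j' ≠ j} [z_{j'}/z_j])⁻¹` (the residue of `dw/(πi w ∏_j [z_j/w])` at `w = z_j`). We take
this as the DEFINITION (`resSum`, over the rapidity field `Frac ℂ[w, z_1, z_2, …]` of
`DiagonalStripGenericRapidities`, site `j : Fin L` ↔ rapidity `z_{j+1}`) and prove the three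
manipulations HL's proofs use: linearity in the numerator (`resSum_add`, …), relabelling of the
rapidities by the swap automorphisms (**`genSwap_resSum`**: `σ_i (Σ_J N) = Σ_J N^{σ_i}`), and the
vanishing of the residue sum of a numerator antisymmetric in two integration variables
(**`resSum_eq_zero_of_antisymm`**), together with the single-term evaluation `resSum_eq_single`.

## References

* C. Hagendorf, J. Liénardy, *The open XXZ chain at Δ = -1/2 and the boundary quantum
  Knizhnik–Zamolodchikov equations*, J. Stat. Mech. (2021) 013104, arXiv:2008.03220, §3.1–3.2.
  [HagendorfLienardy2021]
-/

noncomputable section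

namespace Literature.Probability.Percolation

open Finset MvPolynomial Literature.Probability.LatticeModels.TemperleyLieb

variable {L n : ℕ}

/-! ### Sites and their rapidities -/

section Sites

/-- The rapidity of the site `j` (sites `0, …, L-1` carry `z_1, …, z_L`). [folklore] -/
def zv (j : Fin L) : RapidityField ℂ := genZ ℂ (j.val + 1)

/-- Rapidities are nonzero. [folklore] -/
theorem zv_ne_zero (j : Fin L) : zv j ≠ 0 := genZ_ne_zero _

/-- Distinct sites have rapidities whose ratio does not square to one. [folklore] -/
theorem zv_div_sq_ne_one {j j' : Fin L} (h : j ≠ j') : (zv j / zv j') ^ 2 ≠ 1 := by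
  rw [div_pow, Ne, div_eq_one_iff_eq (pow_ne_zero _ (zv_ne_zero _))]
  unfold zv genZ; rw [← map_pow, ← map_pow]
  refine toRF_ne_of_eval (fun n => if n = j.val + 1 then 0 else 1) ?_
  have : (j' : ℕ) ≠ j := fun h' => h (Fin.ext h'.symm)
  simp [this]

/-- `[z_j/z_{j'}] ≠ 0` for distinct sites. [folklore] -/
theorem qbr_zv_div_ne_zero {j j' : Fin L} (h : j ≠ j') : qbr (zv j / zv j') ≠ 0 :=
  qbr_ne_zero_of_sq_ne_one (div_ne_zero (zv_ne_zero _) (zv_ne_zero _)) (zv_div_sq_ne_one h)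

/-- The transposition of two adjacent sites. [folklore] -/
def siteSwap (s t : Fin L) : Equiv.Perm (Fin L) := Equiv.swap s t

/-- The swap automorphism `σ_{s+1}` permutes the site rapidities by the transposition of the sites
`s` and `t = s + 1`. [folklore] -/
theorem genSwap_zv {s t : Fin L} (hst : t.val = s.val + 1) (j : Fin L) :
    genSwap ℂ (s.val + 1) (zv j) = zv (siteSwap s t j) := by
  unfold zv
  rw [genSwap_genZ, siteSwap, Equiv.swap_apply_def]
  by_cases h1 : j = s
  · subst h1; rw [zswap_self, if_pos rfl, hst]
  · by_cases h2 : j = t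
    · subst h2
      rw [if_neg h1, if_pos rfl, hst, zswap_succ]
    · have h1' : j.val + 1 ≠ s.val + 1 := fun h => h1 (Fin.ext (by omega))
      have h2' : j.val + 1 ≠ s.val + 1 + 1 := fun h => h2 (Fin.ext (by omega))
      rw [zswap_of_ne _ h1' h2', if_neg h1, if_neg h2]

/-- The swap automorphism fixes the constants. [folklore] -/
theorem genSwap_genC' (i : ℕ) (q : ℂ) : genSwap ℂ i (genC ℂ q) = genC ℂ q := genSwap_genC i q

end Sites

/-! ### Residue weights and residue sums -/

section ResSum

/-- **The residue weight of the site `j`**: `ρ(j) = -(∏_{j' ≠ j} [z_{j'}/z_j])⁻¹`, the residue at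
`w = z_j` of `dw/(πi w ∏_{j'} [z_{j'}/w])`. [cite: HagendorfLienardy2021, §3.1] -/
def resWeight (L : ℕ) (j : Fin L) : RapidityField ℂ :=
  -(∏ j' ∈ univ.erase j, qbr (zv j' / zv j))⁻¹

/-- The residue weights are nonzero. [folklore] -/
theorem resWeight_ne_zero (j : Fin L) : resWeight L j ≠ 0 := by
  unfold resWeight
  refine neg_ne_zero.2 (inv_ne_zero (prod_ne_zero_iff.2 fun j' hj' => ?_))
  exact qbr_zv_div_ne_zero (ne_of_mem_erase hj')

/-- **The residue sum** of a numerator `N(w_0, …, w_{n-1})` (the algebraic content of HL's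
`∮⋯∮ ∏ dw_ℓ/(πi w_ℓ) · N(w)/∏_ℓ ∏_j [z_j/w_ℓ]` over contours surrounding the `z_j` only): the sum
over injective pole assignments `J` of `N(z_{J 0}, …, z_{J (n-1)}) ∏_ℓ ρ(J ℓ)`.
[cite: HagendorfLienardy2021, §3.1] -/
def resSum (L n : ℕ) (N : (Fin n → RapidityField ℂ) → RapidityField ℂ) : RapidityField ℂ :=
  ∑ J : Fin n ↪ Fin L, N (fun ℓ => zv (J ℓ)) * ∏ ℓ, resWeight L (J ℓ)

/-- The residue sum is additive in the numerator. [folklore] -/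
theorem resSum_add (N N' : (Fin n → RapidityField ℂ) → RapidityField ℂ) :
    resSum L n (fun w => N w + N' w) = resSum L n N + resSum L n N' := by
  unfold resSum; rw [← sum_add_distrib]; refine sum_congr rfl fun J _ => ?_; ring

/-- The residue sum is homogeneous in the numerator. [folklore] -/
theorem resSum_mul_left (c : RapidityField ℂ) (N : (Fin n → RapidityField ℂ) → RapidityField ℂ) :
    resSum L n (fun w => c * N w) = c * resSum L n N := by
  unfold resSum; rw [mul_sum]; refine sum_congr rfl fun J _ => ?_; ring

/-- The residue sum of a difference. [folklore] -/
theorem resSum_sub (N N' : (Fin n → RapidityField ℂ) → RapidityField ℂ) :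
    resSum L n (fun w => N w - N' w) = resSum L n N - resSum L n N' := by
  unfold resSum; rw [← sum_sub_distrib]; refine sum_congr rfl fun J _ => ?_; ring

/-- The residue sum depends only on the values of the numerator at the pole assignments. [folklore] -/
theorem resSum_congr {N N' : (Fin n → RapidityField ℂ) → RapidityField ℂ}
    (h : ∀ J : Fin n ↪ Fin L, N (fun ℓ => zv (J ℓ)) = N' (fun ℓ => zv (J ℓ))) :
    resSum L n N = resSum L n N' := by
  unfold resSum; exact sum_congr rfl fun J _ => by rw [h J]

/-- **A single surviving term**: if the numerator vanishes at every pole assignment but `J₀`, the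
residue sum is that one term. [cite: HagendorfLienardy2021, Prop. 3.1] -/
theorem resSum_eq_single (N : (Fin n → RapidityField ℂ) → RapidityField ℂ) (J₀ : Fin n ↪ Fin L)
    (h : ∀ J : Fin n ↪ Fin L, J ≠ J₀ → N (fun ℓ => zv (J ℓ)) = 0) :
    resSum L n N = N (fun ℓ => zv (J₀ ℓ)) * ∏ ℓ, resWeight L (J₀ ℓ) := by
  unfold resSum
  rw [sum_eq_single J₀ (fun J _ hJ => by rw [h J hJ, zero_mul]) (fun hJ => absurd (mem_univ _) hJ)]

/-- **A numerator antisymmetric in two integration variables has residue sum zero** (HL: "this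
difference is antisymmetric under the exchange of `w_ℓ` and `w_{ℓ+1}`; hence the multiple contour
integral over the difference vanishes"). [cite: HagendorfLienardy2021, Prop. 3.2] -/
theorem resSum_eq_zero_of_antisymm (N : (Fin n → RapidityField ℂ) → RapidityField ℂ) {ℓ₁ ℓ₂ : Fin n}
    (hℓ : ℓ₁ ≠ ℓ₂) (hN : ∀ w : Fin n → RapidityField ℂ, N (w ∘ Equiv.swap ℓ₁ ℓ₂) = -N w) :
    resSum L n N = 0 := by
  unfold resSum
  -- the involution `J ↦ J ∘ (ℓ₁ ℓ₂)` on injective pole assignments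
  let τ : (Fin n ↪ Fin L) → (Fin n ↪ Fin L) := fun J => (Equiv.swap ℓ₁ ℓ₂).toEmbedding.trans J
  have hτ : ∀ J : Fin n ↪ Fin L, ∀ ℓ, τ J ℓ = J (Equiv.swap ℓ₁ ℓ₂ ℓ) := fun J ℓ => rfl
  refine sum_involution (fun J _ => τ J) (fun J _ => ?_) (fun J _ _ h => ?_) (fun J _ => mem_univ _)
    (fun J _ => ?_)
  · -- the two terms cancel
    have hw : (fun ℓ => zv (τ J ℓ)) = (fun ℓ => zv (J ℓ)) ∘ Equiv.swap ℓ₁ ℓ₂ := by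
      funext ℓ; rw [hτ]; rfl
    have hprod : ∏ ℓ, resWeight L (τ J ℓ) = ∏ ℓ, resWeight L (J ℓ) := by
      simp_rw [hτ]
      exact Fintype.prod_equiv (Equiv.swap ℓ₁ ℓ₂) _ _ fun ℓ => rfl
    rw [hw, hN, hprod]; ring
  · -- no fixed points
    have h1 : τ J ℓ₁ = J ℓ₁ := by rw [h]
    rw [hτ, Equiv.swap_apply_left] at h1
    exact hℓ (J.injective h1).symm
  · -- involutive
    ext ℓ
    rw [hτ, hτ, Equiv.swap_apply_self]

end ResSum

/-! ### Relabelling the rapidities -/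

section Relabel

variable {s t : Fin L}

/-- The swap automorphism commutes with `[·]`. [folklore] -/
theorem genSwap_qbr' (i : ℕ) (x : RapidityField ℂ) : genSwap ℂ i (qbr x) = qbr (genSwap ℂ i x) := by
  unfold qbr; rw [map_sub, map_inv₀]

/-- The swap automorphism permutes the residue weights. [folklore] -/
theorem genSwap_resWeight (hst : t.val = s.val + 1) (j : Fin L) :
    genSwap ℂ (s.val + 1) (resWeight L j) = resWeight L (siteSwap s t j) := by
  unfold resWeight
  rw [map_neg, map_inv₀, map_prod]
  congr 2
  refine prod_nbij (siteSwap s t) (fun j' hj' => ?_) (fun j' _ j'' _ h => (siteSwap s t).injective h)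
    (fun j'' hj'' => ?_) (fun j' _ => ?_)
  · exact mem_erase.2 ⟨fun h => ne_of_mem_erase hj' ((siteSwap s t).injective h), mem_univ _⟩
  · refine ⟨(siteSwap s t).symm j'', mem_erase.2 ⟨fun h => ?_, mem_univ _⟩, Equiv.apply_symm_apply _ _⟩
    exact ne_of_mem_erase (mem_coe.1 hj'') (by rw [← h, Equiv.apply_symm_apply])
  · rw [genSwap_qbr', map_div₀, genSwap_zv hst, genSwap_zv hst]

/-- **Relabelling**: if the swap automorphism transforms the numerator `N` into `N'` evaluated at
the swapped arguments, then `σ_{s+1}` maps the residue sum of `N` to the residue sum of `N'` (the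
contours surround all the `z_j`, a set invariant under relabelling).
[cite: HagendorfLienardy2021, Prop. 3.2] -/
theorem genSwap_resSum (hst : t.val = s.val + 1) (N N' : (Fin n → RapidityField ℂ) → RapidityField ℂ)
    (hN : ∀ w : Fin n → RapidityField ℂ, genSwap ℂ (s.val + 1) (N w) = N' (genSwap ℂ (s.val + 1) ∘ w)) :
    genSwap ℂ (s.val + 1) (resSum L n N) = resSum L n N' := by
  unfold resSum
  rw [map_sum]
  -- reindex the pole assignments by `J ↦ siteSwap ∘ J`
  let π : (Fin n ↪ Fin L) ≃ (Fin n ↪ Fin L) :=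
    { toFun := fun J => J.trans (siteSwap s t).toEmbedding
      invFun := fun J => J.trans (siteSwap s t).symm.toEmbedding
      left_inv := fun J => by ext ℓ; simp
      right_inv := fun J => by ext ℓ; simp }
  refine Fintype.sum_equiv π _ _ fun J => ?_
  rw [map_mul, map_prod, hN]
  have hw : (genSwap ℂ (s.val + 1) ∘ fun ℓ => zv (J ℓ)) = fun ℓ => zv (π J ℓ) := by
    funext ℓ; exact genSwap_zv hst (J ℓ)
  rw [hw]
  congr 1
  exact prod_congr rfl fun ℓ _ => genSwap_resWeight hst (J ℓ)

end Relabel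

end Literature.Probability.Percolation
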